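import Literature.AlgebraicGeometry.Morphisms.SectionsBaseChangeOfFibrewiseVanishing
import Literature.AlgebraicGeometry.Modules.PushforwardBaseChangeHom
import Literature.AlgebraicGeometry.Modules.PushforwardBaseChangeChartsTop
import Literature.AlgebraicGeometry.Modules.PullbackSectionsBaseChange
import HarnessLib

/-!
# `H⁰` and base change from fibrewise `H¹`-vanishing — the chart edition over an affine base

[cite: MumfordAV1970, §5, Corollary 3 (p. 53)]
[cite: Hartshorne1977, III Theorem 12.11 (p. 290)]
[cite: StacksProject, Tag 02KH]

Sequel to ★ `Morphisms/SectionsBaseChangeOfFibrewiseVanishing` (G8), which states «`H⁰` commutes with every affine base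
change» in GLOBAL-SECTION letters (`Γ(B′, 𝒪) ⊗_{Γ(Spec A, 𝒪)} Γ(X, G) ≃ Γ(X ×_A B′, G′)` for an affine SCHEME `B′`).  Its
consumer, the base-change morphism `β : b^*(p_* G) ⟶ (p_T)_*(pr^* G)` of ★ `Modules/PushforwardBaseChangeHom`, reads
charts: for a cartesian square `X_T = X ×_S T` and affine opens `V ⊆ S`, `W ⊆ b⁻¹V`, ★
`Modules.isIso_pushforwardBaseChangeHom_of_charts` (and B-p04 (g19)'s `…ChartsTop` variants for affine `S`, `V = ⊤`) want
`Γ(T, W) ⊗_{Γ(S, V)} Γ(p_* G, V) ≃ Γ((p_T)_*(pr^* G), W)`, `t ⊗ s ↦ t · η_{pr}(s)|_{p_T⁻¹W}` — or that every `Γ(T, W)`-linear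
map with these values is bijective.  MAIN THEOREM (`exists_tensor_pushforward_linearEquiv_of_forall_prime`): exactly this, at
`V = ⊤` over an affine noetherian base `S = Spec A`, for `p` proper flat and `G` finite locally free with
`Ext¹(𝒪_{X_𝔭}, G|_{X_𝔭}) = 0` at every prime (G8's fibre data), ANY `T` and ANY affine open `W ⊆ T`.

Proof.  G8 applies to the cartesian square `p_T⁻¹W = X ×_A W → W` (Mathlib `isPullback_morphismRestrict` pasted to the
given square); §1 (`Literature.Algebra.Module.bijective_of_baseChange_formula_transport`, pure algebra) moves its conclusion
to the chart letters along `Γ(↑W, 𝒪) ≅ Γ(T, W)` (`Scheme.Opens.topIso`), `Γ(X, G) = Γ(p_* G, ⊤)` and the injection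
`Γ(pr^* G, p_T⁻¹W) ↪ Γ(((p_T⁻¹W).ι ≫ pr)^* G, ⊤)`, `n ↦ C(η_ι(n))` (`η_ι` bijective by ★
`Modules.bijective_unitSectionLE_ι`, `C` Mathlib's `pullbackComp`); the unit sections match by ★
`pullbackComp_hom_app_unitSection` / `unitSection_map`, the structure maps by Mathlib's `appLE` calculus
(`map_appLE`, `appLE_map`, `morphismRestrict_app'`, `Scheme.Opens.ι_appLE`) and ★ `appLE_appLE_eq_of_sq`.

Everything is proved; theorems only; no instance, notation, named fact.  Universe `Scheme.{0}`.  Elaboration discipline as in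
G8 (explicit binders, no section variables on the main theorem; hypotheses destructured after `have`; the comparison
`C : ι^* pr^* G ⟶ (ι ≫ pr)^* G` kept opaque between modules in applied form).  Cell `hodgecm-mathlib`, F-DAG (h2) → (h6-d)
(hbc) input, G9 (B-p19 (g15)); consumers: B-p04 (g19) `Modules/PushforwardBaseChangeChartsTop`
(`isIso_pushforwardBaseChangeHom_of_forall_bijective_top`), the Zariski-localisation on the base (S3).  HC_CM is proved
only modulo the 7 printed citations until rung 0 closes — nothing here bears on a summit statement.

## References

* D. Mumford, *Abelian Varieties*, TIFR Studies in Mathematics 5 (1970), §5, Cor. 3 (p. 53). [MumfordAV1970]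
* R. Hartshorne, *Algebraic Geometry*, GTM 52 (1977), III Thm. 12.11 (p. 290); III Prop. 9.3. [Hartshorne1977]
* The Stacks Project, Tag 02KH (flat base change), Tag 02N6 (base change map). [StacksProject]
-/

noncomputable section

set_option backward.isDefEq.respectTransparency false

open CategoryTheory CategoryTheory.Limits CategoryTheory.Abelian Opposite TopologicalSpace AlgebraicGeometry
open TensorProduct

/-! ## §1 Algebra: transport of «`B ⊗_R M ≃ N`, `b ⊗ m ↦ b · η(m)`» along compatible maps -/

namespace Literature.Algebra.Module

/-- **Transport of a base-change isomorphism along compatible identifications** (bijectivity currency).  Data: rings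
`R₁ → B₁`, `R₂ → B₂`, modules `M₁, N₁` and `M₂, N₂`, maps `η₁ : M₁ → N₁`, `η₂ : M₂ → N₂`; a ring map `u : B₁ → B₂`
ONTO, a ring map `v : R₁ → R₂` with `u ∘ (R₁ → B₁) = (R₂ → B₂) ∘ v`, an additive `v`-semilinear `μ : M₁ → M₂` ONTO, an
additive injective `λ : N₂ → N₁` with `λ (u b · n) = b · λ n` and `λ (η₂ (μ m)) = η₁ m`.  If `B₁ ⊗_{R₁} M₁ ≃ N₁` by
`b ⊗ m ↦ b · η₁ m`, then every `B₂`-linear `F₂ : B₂ ⊗_{R₂} M₂ → N₂` with `F₂ (b ⊗ m) = b · η₂ m` is bijective (indeed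
`λ ∘ F₂ ∘ θ = E₁` for the surjection `θ : b ⊗ m ↦ u b ⊗ μ m`).  Used to move «`H⁰` commutes with base change» between the
global-section letters of a restricted square and the chart letters `Γ(T, W) ⊗_{Γ(S, V)} Γ(p_* G, V) ≃ Γ(p_{T*} G_T, W)`.
[cite: StacksProject, Tag 02KH] [cite: Hartshorne1977, III Prop. 9.3 (proof)] -/
theorem bijective_of_baseChange_formula_transport
    {R₁ B₁ M₁ N₁ R₂ B₂ M₂ N₂ : Type*} [CommRing R₁] [CommRing B₁] [Algebra R₁ B₁] [AddCommGroup M₁] [Module R₁ M₁]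
    [AddCommGroup N₁] [Module B₁ N₁] [CommRing R₂] [CommRing B₂] [Algebra R₂ B₂] [AddCommGroup M₂] [Module R₂ M₂]
    [AddCommGroup N₂] [Module B₂ N₂]
    (u : B₁ →+* B₂) (hu : Function.Surjective u) (v : R₁ →+* R₂)
    (huv : ∀ r, u (algebraMap R₁ B₁ r) = algebraMap R₂ B₂ (v r))
    (μ : M₁ →+ M₂) (hμ : ∀ (r : R₁) (m : M₁), μ (r • m) = v r • μ m) (hμs : Function.Surjective μ)
    (l : N₂ →+ N₁) (hl : ∀ (b : B₁) (n : N₂), l (u b • n) = b • l n) (hli : Function.Injective l)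
    (η₁ : M₁ → N₁) (η₂ : M₂ → N₂) (hη : ∀ m, l (η₂ (μ m)) = η₁ m)
    (hE₁ : ∃ E₁ : B₁ ⊗[R₁] M₁ ≃ₗ[B₁] N₁, ∀ (b : B₁) (m : M₁), E₁ (b ⊗ₜ m) = b • η₁ m)
    (F₂ : B₂ ⊗[R₂] M₂ →ₗ[B₂] N₂) (hF₂ : ∀ (b : B₂) (m : M₂), F₂ (b ⊗ₜ m) = b • η₂ m) :
    Function.Bijective F₂ := by
  obtain ⟨E₁, hE₁⟩ := hE₁
  -- `θ : B₁ ⊗ M₁ → B₂ ⊗ M₂`, `b ⊗ m ↦ u b ⊗ μ m`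
  let θ₀ : B₁ →+ M₁ →+ B₂ ⊗[R₂] M₂ :=
    { toFun := fun b => ((TensorProduct.mk R₂ B₂ M₂) (u b)).toAddMonoidHom.comp μ
      map_zero' := by
        ext m
        change u 0 ⊗ₜ[R₂] μ m = 0
        rw [map_zero, TensorProduct.zero_tmul]
      map_add' := fun b b' => by
        ext m
        change u (b + b') ⊗ₜ[R₂] μ m = u b ⊗ₜ[R₂] μ m + u b' ⊗ₜ[R₂] μ m
        rw [map_add, TensorProduct.add_tmul] }
  have hθ₀ : ∀ (r : R₁) (b : B₁) (m : M₁), θ₀ (r • b) m = θ₀ b (r • m) := by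
    intro r b m
    change u (r • b) ⊗ₜ[R₂] μ m = u b ⊗ₜ[R₂] μ (r • m)
    rw [Algebra.smul_def, map_mul, huv, ← Algebra.smul_def, hμ, TensorProduct.smul_tmul]
  let θ : B₁ ⊗[R₁] M₁ →+ B₂ ⊗[R₂] M₂ := TensorProduct.liftAddHom θ₀ hθ₀
  have hθ : ∀ (b : B₁) (m : M₁), θ (b ⊗ₜ m) = u b ⊗ₜ μ m := fun b m => TensorProduct.liftAddHom_tmul θ₀ hθ₀ b m
  have hθs : Function.Surjective θ := by
    intro z
    induction z using TensorProduct.induction_on with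
    | zero => exact ⟨0, map_zero θ⟩
    | tmul b₂ m₂ =>
      obtain ⟨b, rfl⟩ := hu b₂
      obtain ⟨m, rfl⟩ := hμs m₂
      exact ⟨b ⊗ₜ m, hθ b m⟩
    | add x y hx hy =>
      obtain ⟨x₁, rfl⟩ := hx
      obtain ⟨y₁, rfl⟩ := hy
      exact ⟨x₁ + y₁, map_add θ x₁ y₁⟩
  -- `λ ∘ F₂ ∘ θ = E₁`
  have key : ∀ x, l (F₂ (θ x)) = E₁ x := by
    intro x
    induction x using TensorProduct.induction_on with
    | zero => rw [map_zero, map_zero, map_zero, map_zero]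
    | tmul b m => rw [hθ, hF₂, hl, hη, hE₁]
    | add x y hx hy => rw [map_add, map_add, map_add, map_add, hx, hy]
  refine ⟨fun z z' hzz' => ?_, fun y => ?_⟩
  · obtain ⟨x, rfl⟩ := hθs z
    obtain ⟨x', rfl⟩ := hθs z'
    have h : E₁ x = E₁ x' := by rw [← key, ← key, hzz']
    rw [E₁.injective h]
  · obtain ⟨x, hx⟩ := E₁.surjective (l y)
    exact ⟨θ x, hli (by rw [key, hx])⟩

end Literature.Algebra.Module

/-! ## §2 The chart edition over an affine base: ★ FILE D's letters at `V = ⊤` -/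

namespace Literature.AlgebraicGeometry.Morphisms

open Literature.AlgebraicGeometry.Modules Literature.AlgebraicGeometry.HodgeTheory Literature.AlgebraicGeometry.Motives

section ChartsTop

/-! ### Ring-level bookkeeping for an open `W ⊆ T` and the restricted square over it -/

/-- `Γ(↑W, 𝒪) ≅ Γ(T, W)` (`topIso`) carries the structure map of `W → T → S` on global sections to `b♯ : Γ(S, ⊤) → Γ(T, W)`.
[folklore] -/
private theorem topIso_hom_appLE_ι_comp {T S : Scheme.{0}} (b : T ⟶ S) (W : T.Opens) (r : Γ(S, ⊤)) :
    W.topIso.hom ((W.ι ≫ b).appLE ⊤ ⊤ le_top r) = b.appLE ⊤ W le_top r := by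
  have h := Scheme.Hom.appLE_comp_appLE W.ι b ⊤ W ⊤ le_top (Scheme.Opens.ι_preimage_self W).ge
  have h' := congrArg (fun φ : Γ(S, ⊤) ⟶ Γ(W, ⊤) => W.topIso.hom (φ r)) h
  simp only [CommRingCat.comp_apply] at h'
  refine h'.symm.trans ?_
  rw [Scheme.Opens.ι_appLE, Scheme.Opens.topIso_hom, ← CommRingCat.comp_apply, ← Functor.map_comp]
  have key : ∀ (f : op W ⟶ op W) (x : Γ(T, W)), T.presheaf.map f x = x := fun f x => by
    rw [Subsingleton.elim f (𝟙 _), CategoryTheory.Functor.map_id]; rfl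
  exact key _ _

/-- The structure map of `p_T|_W : p_T⁻¹W → W` on global sections, read through `Γ(↑W, 𝒪) ≅ Γ(T, W)`:
`(p_T⁻¹W ↪ X_T)♯(p_T♯(c)) = (p_T|_W)♯(c)` on `Γ(↑(p_T⁻¹ W), 𝒪)`. [folklore] -/
private theorem ι_appLE_app_topIso_hom {T XT : Scheme.{0}} (pT : XT ⟶ T) (W : T.Opens) (c : Γ(W, ⊤)) :
    (pT ⁻¹ᵁ W).ι.appLE (pT ⁻¹ᵁ W) ⊤ (Scheme.Opens.ι_preimage_self _).ge (pT.app W (W.topIso.hom c)) =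
      toSections (pT ∣_ W).appTop.hom ⊤ c := by
  -- both sides are `pT.appLE (W.ι '' ⊤) ((pT⁻¹W).ι '' ⊤) _ c`
  rw [Scheme.Opens.ι_appLE, Scheme.Opens.topIso_hom, Scheme.Hom.app_eq_appLE pT (U := W),
    ← CommRingCat.comp_apply, ← CommRingCat.comp_apply, Scheme.Hom.map_appLE_assoc, Scheme.Hom.appLE_map]
  change _ = ((pT ∣_ W).appTop ≫ (pT ⁻¹ᵁ W).toScheme.presheaf.map (homOfLE le_top).op) c
  rw [Scheme.Hom.appTop, morphismRestrict_app', Scheme.Opens.toScheme_presheaf_map, Scheme.Hom.appLE_map]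

/-- The ring square of the base change read at `⊤ ⊆ S` and `W ⊆ T`: `pr♯(p♯ r)|_{p_T⁻¹W} = p_T♯(b♯ r|_W)`.
[folklore] -/
private theorem appLE_app_eq_app_appLE {X S T XT : Scheme.{0}} {pr : XT ⟶ X} {pT : XT ⟶ T} {p : X ⟶ S}
    {b : T ⟶ S} (w : pr ≫ p = pT ≫ b) (W : T.Opens) (r : Γ(S, ⊤)) :
    pr.appLE (p ⁻¹ᵁ ⊤) (pT ⁻¹ᵁ W)
        ((Scheme.Hom.preimage_mono pT le_top).trans (preimage_preimage_eq_of_sq w ⊤).ge) (p.app ⊤ r) =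
      pT.app W (b.appLE ⊤ W le_top r) := by
  rw [Scheme.Hom.app_eq_appLE p, Scheme.Hom.app_eq_appLE pT]
  exact appLE_appLE_eq_of_sq w (V := ⊤) (W := W) le_top r

/-- **Unit sections along `p_T⁻¹W ↪ X_T → X` compose**: `C(η_ι(η_{pr}(s)|_{p_T⁻¹W})) = η_{ι ≫ pr}(s)` on global sections of
`↑(p_T⁻¹ W)`, `C : ι^* pr^* G ⟶ (ι ≫ pr)^* G` Mathlib's `pullbackComp` (★ `pullbackComp_hom_app_unitSection`, ★
`unitSection_map`). [folklore] -/
private theorem pullbackComp_app_unitSectionLE_ι_unitSectionLE {X S T XT : Scheme.{0}} {pr : XT ⟶ X} {pT : XT ⟶ T}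
    {p : X ⟶ S} {b : T ⟶ S} (w : pr ≫ p = pT ≫ b) (G : X.Modules) (W : T.Opens)
    (C : (Scheme.Modules.pullback (pT ⁻¹ᵁ W).ι).obj ((Scheme.Modules.pullback pr).obj G) ⟶
      (Scheme.Modules.pullback ((pT ⁻¹ᵁ W).ι ≫ pr)).obj G)
    (hC : C = (Scheme.Modules.pullbackComp (pT ⁻¹ᵁ W).ι pr).hom.app G) (s : Γ(G, ⊤)) :
    C.app ⊤ (unitSectionLE (pT ⁻¹ᵁ W).ι ((Scheme.Modules.pullback pr).obj G) (V := pT ⁻¹ᵁ W) (U := ⊤)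
        (Scheme.Opens.ι_preimage_self _).ge
        (unitSectionLE pr G ((Scheme.Hom.preimage_mono pT le_top).trans (preimage_preimage_eq_of_sq w ⊤).ge) s)) =
      unitSectionLE ((pT ⁻¹ᵁ W).ι ≫ pr) G (V := ⊤) (U := ⊤) le_top s := by
  subst hC
  unfold unitSectionLE
  rw [unitSection_map, Scheme.Modules.Hom.app_map_apply, Scheme.Modules.Hom.app_map_apply]
  erw [pullbackComp_hom_app_unitSection pr G (pT ⁻¹ᵁ W).ι (p ⁻¹ᵁ ⊤) s]
  rw [← CategoryTheory.comp_apply, ← Functor.map_comp]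
  rfl

/-- **`H⁰` AND AFFINE BASE CHANGE IN CHART LETTERS** (the hypothesis of ★ `Modules.isIso_pushforwardBaseChangeHom_of_charts`
at `V = ⊤`, for an affine noetherian base): `p : X → Spec A` proper flat, `G` finite locally free with
`Ext¹(𝒪_{X_𝔭}, G|_{X_𝔭}) = 0` at every prime `𝔭` (fibre squares `HX`), `X_T = X ×_A T → T` ANY cartesian square
(`H : IsPullback pr pT p b`) and `W ⊆ T` an affine open.  Then
**`Γ(T, W) ⊗_{Γ(Spec A, 𝒪)} Γ(p_* G, ⊤) ≃ Γ((p_T)_* (pr^* G), W)`, `t ⊗ s ↦ t · η_{pr}(s)|_{p_T⁻¹ W}`**, and every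
`Γ(T, W)`-linear map with these values (e.g. `β_W` of the base-change morphism precomposed with the base-change
identification of `Γ(b^* p_* G, W)`) is bijective.  Proof: ★ `exists_tensor_secMod_top_linearEquiv_of_forall_prime` on the
cartesian square `p_T⁻¹W = X ×_A W → W` (Mathlib `isPullback_morphismRestrict` pasted to `H`), transported to the chart
letters by §1 along `Γ(↑W, 𝒪) ≅ Γ(T, W)` (`Scheme.Opens.topIso`), `Γ(p_* G, ⊤) = Γ(X, G)` and
`Γ(pr^* G, p_T⁻¹ W) ↪ Γ(((p_T⁻¹W).ι ≫ pr)^* G, ⊤)` (`η` along the open immersion, then Mathlib `pullbackComp`; injective by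
★ `Modules.bijective_unitSectionLE_ι`), the unit sections matching by ★ `pullbackComp_hom_app_unitSection`.
[cite: MumfordAV1970, §5 Cor. 3 (p. 53)] [cite: Hartshorne1977, III Thm. 12.11 (p. 290)] [cite: StacksProject, Tag 02KH] -/
theorem exists_tensor_pushforward_linearEquiv_of_forall_prime {A : Type} [CommRing A] [IsNoetherianRing A]
    {X : Scheme.{0}} (p : X ⟶ Spec (CommRingCat.of A)) [IsProper p] [Flat p] (G : X.Modules)
    (hL : IsFiniteLocallyFree G)
    {X₀ : ∀ (𝔭 : Ideal A) [𝔭.IsPrime], Scheme.{0}} (iX : ∀ (𝔭 : Ideal A) [𝔭.IsPrime], X₀ 𝔭 ⟶ X)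
    (f₀ : ∀ (𝔭 : Ideal A) [𝔭.IsPrime], X₀ 𝔭 ⟶ Spec (CommRingCat.of 𝔭.ResidueField))
    (HX : ∀ (𝔭 : Ideal A) [𝔭.IsPrime],
      IsPullback (iX 𝔭) (f₀ 𝔭) p (Spec.map (CommRingCat.ofHom (algebraMap A 𝔭.ResidueField))))
    (hvan : ∀ (𝔭 : Ideal A) [𝔭.IsPrime],
      Subsingleton (Ext.{1} (unitModule (X₀ 𝔭)) ((Scheme.Modules.pullback (iX 𝔭)).obj G) 1))
    {T XT : Scheme.{0}} {pr : XT ⟶ X} {pT : XT ⟶ T} {b : T ⟶ Spec (CommRingCat.of A)}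
    (H : IsPullback pr pT p b) (W : T.Opens) (hW : IsAffineOpen W) :
    letI := (b.appLE ⊤ W le_top).hom.toAlgebra
    (∃ e : Γ(T, W) ⊗[Γ(Spec (CommRingCat.of A), ⊤)] Γ((Scheme.Modules.pushforward p).obj G, ⊤) ≃ₗ[Γ(T, W)]
        Γ((Scheme.Modules.pushforward pT).obj ((Scheme.Modules.pullback pr).obj G), W),
      ∀ (t : Γ(T, W)) (s : Γ(G, p ⁻¹ᵁ ⊤)),
        e (t ⊗ₜ (show Γ((Scheme.Modules.pushforward p).obj G, ⊤) from s)) =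
          t • (show Γ((Scheme.Modules.pushforward pT).obj ((Scheme.Modules.pullback pr).obj G), W) from
            unitSectionLE pr G ((Scheme.Hom.preimage_mono pT le_top).trans (preimage_preimage_eq_of_sq H.w ⊤).ge) s)) ∧
    ∀ F : Γ(T, W) ⊗[Γ(Spec (CommRingCat.of A), ⊤)] Γ((Scheme.Modules.pushforward p).obj G, ⊤) →ₗ[Γ(T, W)]
        Γ((Scheme.Modules.pushforward pT).obj ((Scheme.Modules.pullback pr).obj G), W),
      (∀ (t : Γ(T, W)) (s : Γ(G, p ⁻¹ᵁ ⊤)),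
        F (t ⊗ₜ (show Γ((Scheme.Modules.pushforward p).obj G, ⊤) from s)) =
          t • (show Γ((Scheme.Modules.pushforward pT).obj ((Scheme.Modules.pullback pr).obj G), W) from
            unitSectionLE pr G ((Scheme.Hom.preimage_mono pT le_top).trans (preimage_preimage_eq_of_sq H.w ⊤).ge) s)) →
      Function.Bijective F := by
  letI algB₂ : Algebra Γ(Spec (CommRingCat.of A), ⊤) Γ(T, W) := (b.appLE ⊤ W le_top).hom.toAlgebra
  haveI : IsAffine W := hW
  -- (0) the square `p_T⁻¹W → W` over `W → T → Spec A` is cartesian; (1) ★ G8 on it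
  have Hsq : IsPullback ((pT ⁻¹ᵁ W).ι ≫ pr) (pT ∣_ W) p (W.ι ≫ b) :=
    (isPullback_morphismRestrict pT W).flip.paste_horiz H
  have hG8 := exists_tensor_secMod_top_linearEquiv_of_forall_prime p G hL iX f₀ HX hvan Hsq
  obtain ⟨hE₁, -⟩ := hG8
  -- (2) the structures of the transport (§1): `R₁ = R₂ = Γ(Spec A)`, `B₁ = Γ(↑W)`, `B₂ = Γ(T, W)`
  letI algB₁ : Algebra Γ(Spec (CommRingCat.of A), ⊤) Γ(W, ⊤) := ((W.ι ≫ b).appLE ⊤ ⊤ le_top).hom.toAlgebra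
  letI modRN : Module Γ(Spec (CommRingCat.of A), ⊤)
      Γ((Scheme.Modules.pushforward pT).obj ((Scheme.Modules.pullback pr).obj G), W) :=
    Module.compHom _ (b.appLE ⊤ W le_top).hom
  haveI : IsScalarTower Γ(Spec (CommRingCat.of A), ⊤) Γ(T, W)
      Γ((Scheme.Modules.pushforward pT).obj ((Scheme.Modules.pullback pr).obj G), W) :=
    ⟨fun a c x => mul_smul ((b.appLE ⊤ W le_top).hom a) c x⟩
  have hι : (⊤ : (↑(pT ⁻¹ᵁ W) : Scheme.{0}).Opens) ≤ (pT ⁻¹ᵁ W).ι ⁻¹ᵁ (pT ⁻¹ᵁ W) :=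
    (Scheme.Opens.ι_preimage_self _).ge
  have hi' : pT ⁻¹ᵁ W ≤ pr ⁻¹ᵁ (p ⁻¹ᵁ ⊤) :=
    (Scheme.Hom.preimage_mono pT le_top).trans (preimage_preimage_eq_of_sq H.w ⊤).ge
  -- the comparison `C : ι^* pr^* G ⟶ (ι ≫ pr)^* G` (Mathlib `pullbackComp`), opaque, with its inverse
  have exC : ∃ C : (Scheme.Modules.pullback (pT ⁻¹ᵁ W).ι).obj ((Scheme.Modules.pullback pr).obj G) ⟶
      (Scheme.Modules.pullback ((pT ⁻¹ᵁ W).ι ≫ pr)).obj G, C = (Scheme.Modules.pullbackComp (pT ⁻¹ᵁ W).ι pr).hom.app G :=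
    ⟨_, rfl⟩
  have exD : ∃ D : (Scheme.Modules.pullback ((pT ⁻¹ᵁ W).ι ≫ pr)).obj G ⟶
      (Scheme.Modules.pullback (pT ⁻¹ᵁ W).ι).obj ((Scheme.Modules.pullback pr).obj G),
      D = (Scheme.Modules.pullbackComp (pT ⁻¹ᵁ W).ι pr).inv.app G :=
    ⟨_, rfl⟩
  obtain ⟨C, hC⟩ := exC
  obtain ⟨D, hD⟩ := exD
  have hCD : C ≫ D = 𝟙 _ := by
    rw [hC, hD]
    exact (Scheme.Modules.pullbackComp (pT ⁻¹ᵁ W).ι pr).hom_inv_id_app G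
  -- `μ : Γ(X, G) → Γ(p_* G, ⊤)` (the identity of underlying sections), `v = id`
  let μ : SecMod G p.appTop.hom ⊤ →+ Γ((Scheme.Modules.pushforward p).obj G, ⊤) :=
    { toFun := fun t => show Γ((Scheme.Modules.pushforward p).obj G, ⊤) from
        (show Γ(G, p ⁻¹ᵁ ⊤) from SecMod.val (L := G) (ρ := p.appTop.hom) t)
      map_zero' := rfl
      map_add' := fun _ _ => rfl }
  have hμ : ∀ (r : Γ(Spec (CommRingCat.of A), ⊤)) (t : SecMod G p.appTop.hom ⊤),
      μ (r • t) = (RingHom.id _ r) • μ t := by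
    intro r t
    change (X.presheaf.map (homOfLE (le_top : (⊤ : X.Opens) ≤ ⊤)).op (p.appTop r)) •
        SecMod.val (L := G) (ρ := p.appTop.hom) t =
      (p.app ⊤ r : Γ(X, p ⁻¹ᵁ ⊤)) • (show Γ(G, p ⁻¹ᵁ ⊤) from SecMod.val (L := G) (ρ := p.appTop.hom) t)
    have e1 : (homOfLE (le_top : (⊤ : X.Opens) ≤ ⊤)) = 𝟙 ⊤ := Subsingleton.elim _ _
    rw [e1, op_id, CategoryTheory.Functor.map_id]
    rfl
  have hμs : Function.Surjective μ := fun s => ⟨SecMod.mk (ρ := p.appTop.hom) (show Γ(G, ⊤) from s), rfl⟩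
  -- `λ : Γ((p_T)_* pr^* G, W) = Γ(pr^* G, p_T⁻¹ W) ↪ Γ((ι ≫ pr)^* G, ⊤)`, `n ↦ C(η_ι(n))`
  let l : Γ((Scheme.Modules.pushforward pT).obj ((Scheme.Modules.pullback pr).obj G), W) →+
      SecMod ((Scheme.Modules.pullback ((pT ⁻¹ᵁ W).ι ≫ pr)).obj G) (pT ∣_ W).appTop.hom ⊤ :=
    { toFun := fun n => SecMod.mk (ρ := (pT ∣_ W).appTop.hom) (C.app ⊤
        (unitSectionLE (pT ⁻¹ᵁ W).ι ((Scheme.Modules.pullback pr).obj G) (V := pT ⁻¹ᵁ W) (U := ⊤) hι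
          (show Γ((Scheme.Modules.pullback pr).obj G, pT ⁻¹ᵁ W) from n)))
      map_zero' := by
        apply SecMod.val_injective (ρ := (pT ∣_ W).appTop.hom)
        change C.app ⊤ (unitSectionLE (pT ⁻¹ᵁ W).ι ((Scheme.Modules.pullback pr).obj G) hι 0) = 0
        rw [← unitSectionLEₗ_apply, map_zero, map_zero]
      map_add' := fun n n' => by
        apply SecMod.val_injective (ρ := (pT ∣_ W).appTop.hom)
        change C.app ⊤ (unitSectionLE (pT ⁻¹ᵁ W).ι ((Scheme.Modules.pullback pr).obj G) hι (_ + _)) =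
          C.app ⊤ _ + C.app ⊤ _
        rw [unitSectionLE_add, map_add] }
  have hl : ∀ (c : Γ(W, ⊤)) (n : Γ((Scheme.Modules.pushforward pT).obj ((Scheme.Modules.pullback pr).obj G), W)),
      l (W.topIso.hom.hom c • n) = c • l n := by
    intro c n
    apply SecMod.val_injective (ρ := (pT ∣_ W).appTop.hom)
    change C.app ⊤ (unitSectionLE (pT ⁻¹ᵁ W).ι ((Scheme.Modules.pullback pr).obj G) hι
        ((pT.app W (W.topIso.hom c)) • (show Γ((Scheme.Modules.pullback pr).obj G, pT ⁻¹ᵁ W) from n))) =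
      toSections (pT ∣_ W).appTop.hom ⊤ c •
        C.app ⊤ (unitSectionLE (pT ⁻¹ᵁ W).ι ((Scheme.Modules.pullback pr).obj G) hι
          (show Γ((Scheme.Modules.pullback pr).obj G, pT ⁻¹ᵁ W) from n))
    rw [unitSectionLE_smul, Scheme.Modules.Hom.app_smul, ι_appLE_app_topIso_hom]
  -- injectivity of `λ`: `C` has the left inverse `D`, and `η_ι` on `⊤` is injective (★ S1)
  have hCi : Function.Injective (C.app ⊤) := by
    intro x y hxy
    have h2 := congrArg (D.app ⊤) hxy
    change (C ≫ D).app ⊤ x = (C ≫ D).app ⊤ y at h2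
    rw [hCD, Scheme.Modules.Hom.id_app] at h2
    exact h2
  have hS1 : Function.Injective
      (unitSectionLE (pT ⁻¹ᵁ W).ι ((Scheme.Modules.pullback pr).obj G) (V := pT ⁻¹ᵁ W) (U := ⊤) hι) :=
    (bijective_unitSectionLE_ι ((Scheme.Modules.pullback pr).obj G) (pT ⁻¹ᵁ W) hι).1
  have hli : Function.Injective l := by
    intro n n' h
    have h1 := congrArg (SecMod.val (ρ := (pT ∣_ W).appTop.hom)) h
    exact hS1 (hCi h1)
  -- `η₁ = η_{ι ≫ pr}` on `Γ(X, G)`, `η₂ = η_{pr}|_{p_T⁻¹W}` on `Γ(p_* G, ⊤)`, and `λ (η₂ (μ t)) = η₁ t`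
  have hη : ∀ t : SecMod G p.appTop.hom ⊤,
      l (show Γ((Scheme.Modules.pushforward pT).obj ((Scheme.Modules.pullback pr).obj G), W) from
          unitSectionLE pr G hi' (show Γ(G, p ⁻¹ᵁ ⊤) from μ t)) =
        SecMod.mk (ρ := (pT ∣_ W).appTop.hom)
          (unitSectionLE ((pT ⁻¹ᵁ W).ι ≫ pr) G (V := ⊤) (U := ⊤) le_top (SecMod.val (L := G) (ρ := p.appTop.hom) t)) := by
    intro t
    apply SecMod.val_injective (ρ := (pT ∣_ W).appTop.hom)
    exact pullbackComp_app_unitSectionLE_ι_unitSectionLE H.w G W C hC (SecMod.val (L := G) (ρ := p.appTop.hom) t)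
  -- (3) every compatible `Γ(T, W)`-linear `F` is bijective (§1)
  have hbij : ∀ F : Γ(T, W) ⊗[Γ(Spec (CommRingCat.of A), ⊤)] Γ((Scheme.Modules.pushforward p).obj G, ⊤) →ₗ[Γ(T, W)]
        Γ((Scheme.Modules.pushforward pT).obj ((Scheme.Modules.pullback pr).obj G), W),
      (∀ (t : Γ(T, W)) (s : Γ(G, p ⁻¹ᵁ ⊤)),
        F (t ⊗ₜ (show Γ((Scheme.Modules.pushforward p).obj G, ⊤) from s)) =
          t • (show Γ((Scheme.Modules.pushforward pT).obj ((Scheme.Modules.pullback pr).obj G), W) from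
            unitSectionLE pr G ((Scheme.Hom.preimage_mono pT le_top).trans (preimage_preimage_eq_of_sq H.w ⊤).ge) s)) →
      Function.Bijective F := fun F hF =>
    Literature.Algebra.Module.bijective_of_baseChange_formula_transport W.topIso.hom.hom
      (fun y => ⟨W.topIso.inv y, by rw [← CommRingCat.comp_apply, Iso.inv_hom_id]; rfl⟩) (RingHom.id _)
      (fun r => topIso_hom_appLE_ι_comp b W r) μ hμ hμs l hl hli
      (fun t => SecMod.mk (ρ := (pT ∣_ W).appTop.hom)
        (unitSectionLE ((pT ⁻¹ᵁ W).ι ≫ pr) G (V := ⊤) (U := ⊤) le_top (SecMod.val (L := G) (ρ := p.appTop.hom) t)))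
      (fun s => show Γ((Scheme.Modules.pushforward pT).obj ((Scheme.Modules.pullback pr).obj G), W) from
        unitSectionLE pr G hi' (show Γ(G, p ⁻¹ᵁ ⊤) from s))
      hη hE₁ F (fun t s => hF t s)
  refine ⟨?_, hbij⟩
  -- (4) existence: the base change of the `Γ(Spec A)`-linear `η₂`
  let η₂ₗ : Γ((Scheme.Modules.pushforward p).obj G, ⊤) →ₗ[Γ(Spec (CommRingCat.of A), ⊤)]
      Γ((Scheme.Modules.pushforward pT).obj ((Scheme.Modules.pullback pr).obj G), W) :=
    { toFun := fun s => show Γ((Scheme.Modules.pushforward pT).obj ((Scheme.Modules.pullback pr).obj G), W) from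
        unitSectionLE pr G hi' (show Γ(G, p ⁻¹ᵁ ⊤) from s)
      map_add' := fun s s' => unitSectionLE_add pr G hi' _ _
      map_smul' := fun r s => by
        change unitSectionLE pr G hi' ((p.app ⊤ r : Γ(X, p ⁻¹ᵁ ⊤)) • (show Γ(G, p ⁻¹ᵁ ⊤) from s)) =
          (pT.app W ((b.appLE ⊤ W le_top) r) : Γ(XT, pT ⁻¹ᵁ W)) • unitSectionLE pr G hi' (show Γ(G, p ⁻¹ᵁ ⊤) from s)
        rw [unitSectionLE_smul, appLE_app_eq_app_appLE H.w W r] }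
  refine ⟨LinearEquiv.ofBijective (η₂ₗ.liftBaseChange Γ(T, W)) (hbij _ fun t s => ?_), fun t s => ?_⟩
  · rw [LinearMap.liftBaseChange_tmul]
    rfl
  · rw [LinearEquiv.ofBijective_apply, LinearMap.liftBaseChange_tmul]
    rfl

end ChartsTop

end Literature.AlgebraicGeometry.Morphisms

end
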